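import Summits.QuantumFields.BalabanUV.Beta.EriceRemainderEnclosureHistoryAutonomyComparisonTwoAgesFar

/-!
# EriceRemainderEnclosureHistoryAutonomyComparisonTwoAges — (E59e) ANY TWO AFFINE AGES COMPARE AT ANY SIZE: `B(u) = b + L₁·u_{k₁} + L₂·u_{k₂}` (`b > 0`,
# `1 ≤ k₁ ≠ k₂`, `L₁, L₂ ≥ 0` ARBITRARY) and every `B′ ≥ B` with a zeroth moment and an ISOTONE excess: ANY box solutions from one pin satisfy `h′ ≤ h` at
# every scale (`le_of_isotone_excess_two_ages`) — NEAR ages (ratio `≤ 21`) by the profile condition of (E58b) (`profileSum_le_two_of_two_ages`), FAR ages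
# (ratio `≥ 21`) by the peeling step of (E59d)

Cell `pub-balaban`, β-function sub-cell, BINDER row D4 «RemainderConst leaves for Bałaban's split» (`HOME/BINDER-OWNERS.md`; owner lineage `b2b-balaban-beta-an4`;
this file by co-owner #2 lineage `b2b-balaban-beta-d4-p2`, generation 51), β-FLOW TEAM duty (1), FREEZE (0) honoured (def-free; (E58a)'s
`le_of_isotone_excess_of_step`, (E58b)'s `le_of_isotone_excess_affine_profile`, (E59c)'s `sum_pair`, (E59d)'s `effective_le_of_family_le_at_two_ages_far`,
(E41)'s `affine_monotone` ∕ `affine_floor` ∕ `affine_zerothMoment` BY NAME; nothing restated).  Closes the third station of gen 51.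

HONEST FRAMING (page 1, verbatim and binding).  *"Discharging BetaPertH makes Bałaban's UV stability UNCONDITIONAL — a real constructive-QFT result; it is
NOT the continuum limit and NOT the Clay problem."*  THIS FILE DISCHARGES NOTHING OF THE KIND.  Elementary real analysis about an ABSTRACT affine functional
with two memory ages — hypotheses of a census, not facts; the form of Bałaban's (1.22) limit functional is NOT PRINTED ([I] p. 298; GAPS G-t4-U2-1∕-2) and NOT
asserted.  Row D4 class UNCHANGED (critical-path width 0; instance 0∕1; D4 DISCHARGE NO DATE).  HONEST DEPENDENCY: continuum YM on T⁴ ⇐ BetaPertH ∧ nine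
spine estimates (0/9 proved); BetaPertH ⇐ (D1) ∧ (D4) ∧ CAP+tail; G-an2-4 gates asym, D1 and NE2/3/4.

THE POINT (census sense (α); the COMPARISON column).  §1: for two ages with ratio at most `21` either way, the profile condition of (E58b) holds for ALL sizes:
`L₁∕P₁ + L₂∕P₂ ≤ 2` with `P₁ = L₁∕√2 + L₂·s`, `P₂ = L₁·s′ + L₂∕√2`, `s = √(k₁∕(k₁+k₂))`, `s′ = √(k₂∕(k₁+k₂))`, is the positivity of the quadratic form
`(√2−1)s′·L₁² + (1 + 2ss′ − √2)·L₁L₂ + (√2−1)s·L₂²`, and `2ss′ = 2√(k₁k₂)∕(k₁+k₂) ≥ √(84∕484) > √2 − 1` exactly when `(21k₁ − k₂)(21k₂ − k₁) ≥ 0`.  §2: the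
assembled theorem — near ages by (E58b), far ages (`k₂ ≥ 21k₁`, or symmetrically) by (E58a)'s principle with (E59d)'s step.  So the comparison column now
reads: zeroth moment alone ⟺ `M·γ ≤ 3√3·b`; ONE affine age free ((E57a)); profiles passing `Σ_j L_j∕P_j ≤ 2` free ((E58b)); and ANY TWO affine ages free
— the first class beyond level-weight bookkeeping (two hyper-separated ages have unbounded-type level weight `≈ 2.7`, `g51/e58/README.md`).  NOT CLAIMED:
three or more arbitrary ages (conjecture (E58′) — the peeling recursion is the successor's), a Markov term riding along with two far ages (harmless, untyped),
necessity, anything printed.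

WHAT IS PROVED ([folklore]; 0 `def`, 0 sorry).  §1 `two_sqrt_prod_ge`, **`profileSum_le_two_of_two_ages`**.  §2 `le_of_isotone_excess_two_ages_far`,
**`le_of_isotone_excess_two_ages`**.
-/
noncomputable section
open Finset Set

namespace Summit.QuantumFields.BalabanUV.Beta.EriceRemainderEnclosureHistoryAutonomyComparisonTwoAges

open Literature.MathematicalPhysics.QuantumFieldTheory.Balaban1983to89
open Literature.MathematicalPhysics.QuantumFieldTheory.Balaban1983to89.T4BetaStationary
open Literature.MathematicalPhysics.QuantumFieldTheory.Balaban1983to89.T4BetaFlowWellPosed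
open Summit.QuantumFields.BalabanUV.Beta.EriceRemainderEnclosureHistoryAutonomyComparisonPrinciple (le_of_isotone_excess_of_step)
open Summit.QuantumFields.BalabanUV.Beta.EriceRemainderEnclosureHistoryAutonomyComparisonAffineProfile (le_of_isotone_excess_affine_profile)
open Summit.QuantumFields.BalabanUV.Beta.EriceRemainderEnclosureHistoryAutonomyComparisonTwoAgesLemmas (sum_pair)
open Summit.QuantumFields.BalabanUV.Beta.EriceRemainderEnclosureHistoryAutonomyComparisonTwoAgesFar (effective_le_of_family_le_at_two_ages_far)
open Summit.QuantumFields.BalabanUV.Beta.EriceRemainderEnclosureHistoryAutonomyMonotone (affine_monotone affine_floor affine_zerothMoment)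

variable {B' : (ℕ → ℝ) → ℝ} {M' γ b : ℝ} {L : ℕ → ℝ} {K k₁ k₂ : ℕ} {h h' : ℕ → ℝ}

/-! ## §1 Two ages with ratio at most 21 pass the profile condition -/

/-- For `1 ≤ k₁, k₂` with `k₂ ≤ 21·k₁` and `k₁ ≤ 21·k₂`: `2·√(k₁∕(k₁+k₂))·√(k₂∕(k₁+k₂)) ≥ 0.4165 (> √2 − 1)` — from
`484·4k₁k₂ − 84(k₁+k₂)² = 4(21k₁ − k₂)(21k₂ − k₁) ≥ 0`. [folklore] -/
theorem two_sqrt_prod_ge (hk₁ : 1 ≤ k₁) (hk₂ : 1 ≤ k₂) (h12 : k₂ ≤ 21 * k₁) (h21 : k₁ ≤ 21 * k₂) :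
    0.4165 ≤ 2 * (Real.sqrt ((k₁ : ℝ) / ((k₁ : ℝ) + k₂)) * Real.sqrt ((k₂ : ℝ) / ((k₂ : ℝ) + k₁))) := by
  have hk₁r : (1 : ℝ) ≤ k₁ := by exact_mod_cast hk₁
  have hk₂r : (1 : ℝ) ≤ k₂ := by exact_mod_cast hk₂
  have h12r : (k₂ : ℝ) ≤ 21 * k₁ := by exact_mod_cast h12
  have h21r : (k₁ : ℝ) ≤ 21 * k₂ := by exact_mod_cast h21
  have hS : (0 : ℝ) < (k₁ : ℝ) + k₂ := by linarith
  set σ : ℝ := 2 * (Real.sqrt ((k₁ : ℝ) / ((k₁ : ℝ) + k₂)) * Real.sqrt ((k₂ : ℝ) / ((k₂ : ℝ) + k₁))) with hσ_def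
  have hσ0 : 0 ≤ σ := by positivity
  have hσsq : σ * σ = 4 * ((k₁ : ℝ) * k₂) / (((k₁ : ℝ) + k₂) * ((k₁ : ℝ) + k₂)) := by
    rw [hσ_def, show (k₂ : ℝ) + k₁ = (k₁ : ℝ) + k₂ by ring]
    have e1 := Real.mul_self_sqrt (div_nonneg (by linarith : (0 : ℝ) ≤ k₁) hS.le)
    have e2 := Real.mul_self_sqrt (div_nonneg (by linarith : (0 : ℝ) ≤ k₂) hS.le)
    calc 2 * (Real.sqrt ((k₁ : ℝ) / ((k₁ : ℝ) + k₂)) * Real.sqrt ((k₂ : ℝ) / ((k₁ : ℝ) + k₂))) *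
          (2 * (Real.sqrt ((k₁ : ℝ) / ((k₁ : ℝ) + k₂)) * Real.sqrt ((k₂ : ℝ) / ((k₁ : ℝ) + k₂))))
        = 4 * ((Real.sqrt ((k₁ : ℝ) / ((k₁ : ℝ) + k₂)) * Real.sqrt ((k₁ : ℝ) / ((k₁ : ℝ) + k₂))) *
            (Real.sqrt ((k₂ : ℝ) / ((k₁ : ℝ) + k₂)) * Real.sqrt ((k₂ : ℝ) / ((k₁ : ℝ) + k₂)))) := by ring
      _ = 4 * (((k₁ : ℝ) / ((k₁ : ℝ) + k₂)) * ((k₂ : ℝ) / ((k₁ : ℝ) + k₂))) := by rw [e1, e2]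
      _ = 4 * ((k₁ : ℝ) * k₂) / (((k₁ : ℝ) + k₂) * ((k₁ : ℝ) + k₂)) := by field_simp
  have hlow : 84 / 484 ≤ σ * σ := by
    rw [hσsq, le_div_iff₀ (by positivity)]
    nlinarith [mul_nonneg (by linarith : (0 : ℝ) ≤ 21 * k₁ - k₂) (by linarith : (0 : ℝ) ≤ 21 * k₂ - k₁)]
  nlinarith [mul_nonneg hσ0 hσ0, hlow]

/-- **TWO AGES WITH RATIO AT MOST 21 PASS THE PROFILE CONDITION**: `L ≥ 0` supported on `{k₁, k₂} ⊆ range K`, `1 ≤ k₁ ≠ k₂`, `k₂ ≤ 21k₁`, `k₁ ≤ 21k₂`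
⟹ `Σ_{j<K} L_j ∕ P_j ≤ 2`, `P_j = Σ_{k<K} L_k·√(j∕(j+k))` — for ALL sizes `L_{k₁}, L_{k₂}`. [folklore] -/
theorem profileSum_le_two_of_two_ages (hL : ∀ k, 0 ≤ L k) (hk₁ : 1 ≤ k₁) (hk₂ : 1 ≤ k₂) (hne : k₁ ≠ k₂) (hk₁K : k₁ ∈ range K)
    (hk₂K : k₂ ∈ range K) (h12 : k₂ ≤ 21 * k₁) (h21 : k₁ ≤ 21 * k₂) (hsupp : ∀ k ∈ range K, k ≠ k₁ → k ≠ k₂ → L k = 0) :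
    ∑ j ∈ range K, L j / ∑ k ∈ range K, L k * Real.sqrt ((j : ℝ) / ((j : ℝ) + k)) ≤ 2 := by
  have hk₁r : (1 : ℝ) ≤ k₁ := by exact_mod_cast hk₁
  have hk₂r : (1 : ℝ) ≤ k₂ := by exact_mod_cast hk₂
  -- the sum has two summands, each P has two terms
  set s : ℝ := Real.sqrt ((k₁ : ℝ) / ((k₁ : ℝ) + k₂)) with hs_def
  set s' : ℝ := Real.sqrt ((k₂ : ℝ) / ((k₂ : ℝ) + k₁)) with hs'_def
  set ρ : ℝ := Real.sqrt (1 / 2) with hρ_def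
  have hρ0 : 0 < ρ := Real.sqrt_pos.mpr (by norm_num)
  have hρsq : ρ * ρ = 1 / 2 := Real.mul_self_sqrt (by norm_num)
  have hs0 : 0 ≤ s := Real.sqrt_nonneg _
  have hs'0 : 0 ≤ s' := Real.sqrt_nonneg _
  have hP₁ : ∑ k ∈ range K, L k * Real.sqrt ((k₁ : ℝ) / ((k₁ : ℝ) + k)) = L k₁ * ρ + L k₂ * s := by
    rw [sum_pair hk₁K hk₂K hne hsupp (fun k => Real.sqrt ((k₁ : ℝ) / ((k₁ : ℝ) + k))), hρ_def, hs_def]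
    rw [show (k₁ : ℝ) / ((k₁ : ℝ) + k₁) = 1 / 2 by field_simp; ring]
  have hP₂ : ∑ k ∈ range K, L k * Real.sqrt ((k₂ : ℝ) / ((k₂ : ℝ) + k)) = L k₁ * s' + L k₂ * ρ := by
    rw [sum_pair hk₁K hk₂K hne hsupp (fun k => Real.sqrt ((k₂ : ℝ) / ((k₂ : ℝ) + k))), hρ_def, hs'_def]
    rw [show (k₂ : ℝ) / ((k₂ : ℝ) + k₂) = 1 / 2 by field_simp; ring]
  have hsum : ∑ j ∈ range K, L j / ∑ k ∈ range K, L k * Real.sqrt ((j : ℝ) / ((j : ℝ) + k))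
      = L k₁ / (L k₁ * ρ + L k₂ * s) + L k₂ / (L k₁ * s' + L k₂ * ρ) := by
    have := sum_pair hk₁K hk₂K hne hsupp (fun j => 1 / ∑ k ∈ range K, L k * Real.sqrt ((j : ℝ) / ((j : ℝ) + k)))
    simp only [mul_one_div] at this
    rw [this, hP₁, hP₂]
  rw [hsum]
  -- the numerical facts: 2ρ = √2 ∈ [1, 1.4143), 2ss′ ≥ 0.4165
  have h2ρ_hi : 2 * ρ < 1.4143 := by nlinarith
  have h2ρ_lo : 1 ≤ 2 * ρ := by nlinarith
  have hσ := two_sqrt_prod_ge hk₁ hk₂ h12 h21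
  rw [← hs_def, ← hs'_def] at hσ
  -- degenerate cases
  rcases (hL k₁).eq_or_lt with hL₁ | hL₁
  · rw [← hL₁]; simp only [zero_div, zero_mul, zero_add]
    rcases (hL k₂).eq_or_lt with hL₂ | hL₂
    · rw [← hL₂]; simp
    · rw [div_le_iff₀ (by positivity)]; nlinarith
  rcases (hL k₂).eq_or_lt with hL₂ | hL₂
  · rw [← hL₂]; simp only [zero_div, zero_mul, add_zero]
    rw [div_le_iff₀ (by positivity)]; nlinarith
  -- main case: clear denominators and use the quadratic form
  have hD₁ : 0 < L k₁ * ρ + L k₂ * s := by nlinarith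
  have hD₂ : 0 < L k₁ * s' + L k₂ * ρ := by nlinarith
  rw [div_add_div _ _ hD₁.ne' hD₂.ne', div_le_iff₀ (mul_pos hD₁ hD₂)]
  -- 2 D₁ D₂ − (L₁ D₂ + L₂ D₁) = (2ρ−1)s′L₁² + (2ρ² + 2ss′ − 2ρ)L₁L₂ + (2ρ−1)s L₂²
  have hmid : 0 ≤ 2 * (ρ * ρ) + 2 * (s * s') - 2 * ρ := by rw [hρsq]; linarith
  nlinarith [mul_nonneg (mul_nonneg (by linarith : (0:ℝ) ≤ 2 * ρ - 1) hs'0) (mul_nonneg hL₁.le hL₁.le),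
    mul_nonneg (mul_nonneg (by linarith : (0:ℝ) ≤ 2 * ρ - 1) hs0) (mul_nonneg hL₂.le hL₂.le),
    mul_nonneg hmid (mul_nonneg hL₁.le hL₂.le)]

/-! ## §2 The assembled theorem -/

/-- **TWO AFFINE AGES FAR APART COMPARE AT ANY SIZE** (family-free form of (E59d)'s step): `B = b + Σ_{k<K} L_k·u_k` with `L ≥ 0` supported on `{k₁, k₂}`,
`1 ≤ k₁`, `21·k₁ ≤ k₂ < K`; `B′` with a zeroth moment, `B ≤ B′`, ISOTONE excess; then ANY box solutions from one pin satisfy `h′ ≤ h` at every scale —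
WHATEVER `L_{k₁}, L_{k₂}`. [folklore] -/
theorem le_of_isotone_excess_two_ages_far {p : ℝ} (hL : ∀ k, 0 ≤ L k) (hb : 0 < b) (hk₁ : 1 ≤ k₁) (hfar : 21 * k₁ ≤ k₂) (hk₂K : k₂ < K)
    (hsupp : ∀ k ∈ range K, k ≠ k₁ → k ≠ k₂ → L k = 0)
    (hB' : ∀ u u' : ℕ → ℝ, SeqBox γ u → SeqBox γ u' → ∀ D : ℝ, (∀ j, |u j - u' j| ≤ D) → |B' u - B' u'| ≤ M' * D) (hM' : 0 ≤ M')
    (hexc : ∀ u, SeqBox γ u → (fun u : ℕ → ℝ => b + ∑ k ∈ range K, L k * u k) u ≤ B' u)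
    (hDmono : ∀ u v : ℕ → ℝ, SeqBox γ u → SeqBox γ v → (∀ j, u j ≤ v j) →
      B' u - (fun u : ℕ → ℝ => b + ∑ k ∈ range K, L k * u k) u ≤ B' v - (fun u : ℕ → ℝ => b + ∑ k ∈ range K, L k * u k) v)
    (hp : 0 < p) (hpγ : p ≤ γ) (hh : SeqBox γ h) (hf : MemFlow (fun u : ℕ → ℝ => b + ∑ k ∈ range K, L k * u k) p h)
    (hh' : SeqBox γ h') (hf' : MemFlow B' p h') (j : ℕ) : h' j ≤ h j :=
  le_of_isotone_excess_of_step (B := fun u : ℕ → ℝ => b + ∑ k ∈ range K, L k * u k) (affine_monotone hL)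
    (affine_zerothMoment hL) (sum_nonneg fun k _ => hL k) hb (affine_floor hL) hB' hM' hexc hDmono
    (fun _ hy _ _ _ hu hfu hu' hfu' hle =>
      effective_le_of_family_le_at_two_ages_far hL hb hk₁ hfar hk₂K hsupp hexc hDmono hy hu hfu hu' hfu' hle)
    hp hpγ hh hf hh' hf' j

/-- **ANY TWO AFFINE AGES COMPARE AT ANY SIZE.**  `B(u) = b + Σ_{k<K} L_k·u_k` on ]0,γ] with `b > 0`, `L ≥ 0` supported on two ages `{k₁, k₂} ⊆ [1, K[`,
`k₁ ≠ k₂` — i.e. `B(u) = b + L₁·u_{k₁} + L₂·u_{k₂}` with `L₁, L₂ ≥ 0` of ANY sizes and ANY two memory ages; `B′` with zeroth moment `M′ ≥ 0`, `B ≤ B′` on the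
box, the EXCESS `B′ − B` ISOTONE; `h`, `h′` ANY box solutions of `B`, `B′` from one pin `p ∈ ]0,γ]`.  Then `h′ ≤ h` at EVERY scale.  (Ratio `≤ 21`: the
profile condition, (E58b); ratio `≥ 21`: peeling the young age, (E59d).  Equal ages are one age — (E57a).) [folklore] -/
theorem le_of_isotone_excess_two_ages {p : ℝ} (hL : ∀ k, 0 ≤ L k) (hb : 0 < b) (hk₁ : 1 ≤ k₁) (hk₂ : 1 ≤ k₂) (hne : k₁ ≠ k₂)
    (hk₁K : k₁ < K) (hk₂K : k₂ < K) (hsupp : ∀ k ∈ range K, k ≠ k₁ → k ≠ k₂ → L k = 0)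
    (hB' : ∀ u u' : ℕ → ℝ, SeqBox γ u → SeqBox γ u' → ∀ D : ℝ, (∀ j, |u j - u' j| ≤ D) → |B' u - B' u'| ≤ M' * D) (hM' : 0 ≤ M')
    (hexc : ∀ u, SeqBox γ u → (fun u : ℕ → ℝ => b + ∑ k ∈ range K, L k * u k) u ≤ B' u)
    (hDmono : ∀ u v : ℕ → ℝ, SeqBox γ u → SeqBox γ v → (∀ j, u j ≤ v j) →
      B' u - (fun u : ℕ → ℝ => b + ∑ k ∈ range K, L k * u k) u ≤ B' v - (fun u : ℕ → ℝ => b + ∑ k ∈ range K, L k * u k) v)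
    (hp : 0 < p) (hpγ : p ≤ γ) (hh : SeqBox γ h) (hf : MemFlow (fun u : ℕ → ℝ => b + ∑ k ∈ range K, L k * u k) p h)
    (hh' : SeqBox γ h') (hf' : MemFlow B' p h') (j : ℕ) : h' j ≤ h j := by
  by_cases hfar : 21 * k₁ ≤ k₂
  · exact le_of_isotone_excess_two_ages_far hL hb hk₁ hfar hk₂K hsupp hB' hM' hexc hDmono hp hpγ hh hf hh' hf' j
  by_cases hfar' : 21 * k₂ ≤ k₁
  · have hsupp' : ∀ k ∈ range K, k ≠ k₂ → k ≠ k₁ → L k = 0 := fun k hk h2 h1 => hsupp k hk h1 h2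
    exact le_of_isotone_excess_two_ages_far hL hb hk₂ hfar' hk₁K hsupp' hB' hM' hexc hDmono hp hpγ hh hf hh' hf' j
  · exact le_of_isotone_excess_affine_profile hL hb
      (profileSum_le_two_of_two_ages hL hk₁ hk₂ hne (mem_range.mpr hk₁K) (mem_range.mpr hk₂K) (not_le.mp hfar).le
        (not_le.mp hfar').le hsupp)
      hB' hM' hexc hDmono hp hpγ hh hf hh' hf' j

end Summit.QuantumFields.BalabanUV.Beta.EriceRemainderEnclosureHistoryAutonomyComparisonTwoAges

end
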